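import Mathlib
import Summits.Ventures.FusionMHD.Models.TearingFRS1Gronwall
import Literature.Analysis.ODE.RationalTaylorMajorant
import Literature.Analysis.ODE.RegularSingularSharpRadius
import Literature.Analysis.ODE.FrobeniusSeriesTruncation
import HarnessLib

/-!
# F3.r3 instance «TearingFRS1»: shared facts for the REGULAR POINTS of the right outer solve

Companion of `TearingFRS1Gronwall.lean` (model-6; `models/F3-SCOPING.md` §7b). At a regular point `u₀ > 1` of MODEL M
the outer equation, written in `x = u − u₀` and multiplied by `x`, is `x ψ″ + p̃(x) ψ′ + q̃(x) ψ = 0` with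
`p̃ = x/(u₀ + x)` and `q̃ = −x c(u₀ + x)`: BOTH vanish at `0`, so the Frobenius system has `M₀ = 0`, `Rₙ = id/n`, and
EVERY initial vector `(ψ, ψ′)(u₀)` is admissible — the series through it is the Taylor series of the solution. Generic
pieces used by every point file `TearingFRS1R<k>*.lean`:
* `ratTaylorCoeff_lin_zero/succ`, `norm_ratTaylorCoeff_lin_le`, `hasSum_lin` — the data of `p̃ = (bx)/(1 + bx)`,
  `b = 1/u₀`: coefficients `0, b, −b², b³, …`, bound `bⁿ`, sum on `‖x‖ < 1/b`;
* `hasDerivAt_frobeniusSol_zero` — the derivative of a Frobenius series at the centre is its first coefficient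
  (the ODE AT the centre, where `x • v′ = M(x) v` is vacuous);
* `scalarSysR_regular` — `Rₙ w = (w₁/n, w₂/n)` when `p₀ = q₀ = 0`, and `norm_scalarSysR_regular : ‖Rₙ‖ ≤ 1/n`.
[instance data / folklore]
-/

noncomputable section

open Finset Filter Polynomial Literature.Analysis.ODE
open scoped Topology

namespace Summit.Ventures.FusionMHD.Models

namespace TearingFRS1

/-! ### The `p̃`-data `x/(u₀ + x) = (bx)/(1 + bx)`, `b = 1/u₀` -/

/-- The recursion: `c_{n+1} = [n = 0]·b − b·c_n` for `c = ratTaylorCoeff (C b * X) (1 + C b * X)`. [folklore] -/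
theorem ratTaylorCoeff_lin_rec (b : ℝ) (n : ℕ) :
    ratTaylorCoeff (C b * X) (1 + C b * X) (n + 1) =
      (if n = 0 then b else 0) - b * ratTaylorCoeff (C b * X) (1 + C b * X) n := by
  rw [ratTaylorCoeff_eq, Finset.sum_range_succ, Nat.add_sub_cancel_left]
  have h0 : ∑ k ∈ range n, (1 + C b * X : ℝ[X]).coeff (n + 1 - k) * ratTaylorCoeff (C b * X) (1 + C b * X) k = 0 := by
    refine Finset.sum_eq_zero fun k hk => ?_
    have hk := Finset.mem_range.1 hk
    have : (1 + C b * X : ℝ[X]).coeff (n + 1 - k) = 0 := by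
      rw [coeff_add, coeff_one, coeff_C_mul, coeff_X]
      have h1 : n + 1 - k ≠ 0 := by omega
      have h2 : (1 : ℕ) ≠ n + 1 - k := by omega
      simp [h1, h2]
    rw [this, zero_mul]
  rw [h0, zero_add, coeff_C_mul, coeff_X, coeff_add, coeff_one, coeff_C_mul, coeff_X]
  rcases Nat.eq_zero_or_pos n with rfl | hn
  · simp
  · have h2 : n ≠ 0 := by omega
    simp [h2]

/-- `c₀ = 0`. [folklore] -/
theorem ratTaylorCoeff_lin_zero (b : ℝ) : ratTaylorCoeff (C b * X) (1 + C b * X) 0 = 0 := by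
  rw [ratTaylorCoeff_eq]; simp

/-- CLOSED FORM `c_{n+1} = (−1)ⁿ b^{n+1}`. [folklore] -/
theorem ratTaylorCoeff_lin_succ (b : ℝ) (n : ℕ) :
    ratTaylorCoeff (C b * X) (1 + C b * X) (n + 1) = (-1) ^ n * b ^ (n + 1) := by
  induction n with
  | zero => rw [ratTaylorCoeff_lin_rec, ratTaylorCoeff_lin_zero]; simp
  | succ n ih => rw [ratTaylorCoeff_lin_rec, ih]; simp [pow_succ]; ring

/-- `|c_n| ≤ |b|ⁿ` (with `c₀ = 0 ≤ 1`). [folklore] -/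
theorem norm_ratTaylorCoeff_lin_le (b : ℝ) (n : ℕ) : ‖ratTaylorCoeff (C b * X) (1 + C b * X) n‖ ≤ |b| ^ n := by
  rcases n with _ | n
  · rw [ratTaylorCoeff_lin_zero]; simp
  · rw [ratTaylorCoeff_lin_succ, norm_mul, norm_pow, norm_neg, norm_one, one_pow, one_mul, norm_pow,
      Real.norm_eq_abs]

/-- `Σ xⁿ c_n = (bx)/(1 + bx)` on `|b x| < 1`. [folklore] -/
theorem hasSum_lin (b : ℝ) {x : ℝ} (hx : ‖b * x‖ < 1) :
    HasSum (fun n => x ^ n * ratTaylorCoeff (C b * X) (1 + C b * X) n) (b * x / (1 + b * x)) := by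
  have hg : HasSum (fun n : ℕ => (-(b * x)) ^ n) (1 - -(b * x))⁻¹ :=
    hasSum_geometric_of_norm_lt_one (by rwa [norm_neg])
  refine (hasSum_nat_add_iff' 1).1 ?_
  have h0 : ∑ i ∈ range 1, x ^ i * ratTaylorCoeff (C b * X) (1 + C b * X) i = 0 := by
    simp [ratTaylorCoeff_lin_zero]
  rw [h0, sub_zero]
  have e : (fun n : ℕ => x ^ (n + 1) * ratTaylorCoeff (C b * X) (1 + C b * X) (n + 1)) =
      fun n : ℕ => b * x * (-(b * x)) ^ n := by
    funext n
    rw [ratTaylorCoeff_lin_succ, neg_pow (b * x), mul_pow, pow_succ, pow_succ]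
    ring
  rw [e, show b * x / (1 + b * x) = b * x * (1 - -(b * x))⁻¹ by rw [sub_neg_eq_add, div_eq_mul_inv]]
  exact hg.mul_left (b * x)

/-! ### The derivative of a Frobenius series at its centre -/

section Centre

variable {E : Type*} [NormedAddCommGroup E] [NormedSpace ℝ E] [CompleteSpace E]

/-- At the centre `x = 0` the series `Σ xⁿ • wₙ` (geometric coefficient bound) has derivative `w₁`. [folklore] -/
theorem hasDerivAt_tsum_pow_smul_zero {w : ℕ → E} {B lam : ℝ} (hw : ∀ n, ‖w n‖ ≤ B * lam ^ n) (hlam : 0 ≤ lam) :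
    HasDerivAt (fun y : ℝ => ∑' n, y ^ n • w n) (w 1) 0 := by
  have h := (hasDerivAt_tsum_pow_smul (𝕜 := ℝ) hw hlam (x := 0) (by simp)).2
  have e : (∑' n : ℕ, ((n : ℝ) * (0 : ℝ) ^ (n - 1)) • w n) = w 1 := by
    rw [tsum_eq_single 1]
    · simp
    · intro n hn
      rcases n with _ | n
      · simp
      · have : n ≠ 0 := by rintro rfl; exact hn rfl
        simp [this]
  rwa [e] at h

end Centre

/-! ### The resolvent at a regular point -/

/-- `Rₙ w = (w₁/n, w₂/n)` when `p₀ = q₀ = 0`. [folklore] -/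
theorem scalarSysR_regular {pc qc : ℕ → ℝ} (hp : pc 0 = 0) (hq : qc 0 = 0) {n : ℕ} (hn : n ≠ 0) (w : ℝ × ℝ) :
    scalarSysR pc qc n w = ((n : ℝ)⁻¹ * w.1, (n : ℝ)⁻¹ * w.2) := by
  have hn' : (n : ℝ) ≠ 0 := Nat.cast_ne_zero.2 hn
  rw [scalarSysR_apply, hp, hq]
  ext
  · rfl
  · simp only [add_zero, neg_zero, zero_mul, zero_add]
    field_simp

/-- `‖Rₙ‖ ≤ 1/n` when `p₀ = q₀ = 0` (`c = 1`). [folklore] -/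
theorem norm_scalarSysR_regular {pc qc : ℕ → ℝ} (hp : pc 0 = 0) (hq : qc 0 = 0) {n : ℕ} (hn : 1 ≤ n) :
    ‖scalarSysR pc qc n‖ ≤ 1 / n := by
  have h := norm_scalarSysR_le_sharp pc qc hn (by rw [hp, add_zero, RCLike.norm_natCast])
  rw [hq, norm_zero, zero_div, add_zero] at h
  exact h

end TearingFRS1

end Summit.Ventures.FusionMHD.Models

end
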